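import Literature.GroupTheory.SurfaceNormalSubgroupCompletionCentralizer
import HarnessLib

/-!
# Finite-order outer automorphisms of free and surface groups that are inner in the profinite
# completion are inner (`Out(Λ) → Out(Λ̂)` is injective on finite subgroups)

Topic `Literature/GroupTheory` (abc-iut cell, campaign-L row «OUT-PROFINITE», the residual (OUT)
«`Aut(X) → Out(π̂₁(X))` injective» of the `EA`/(H1′) column of [AbsTopIII] Prop. 4.2 (i), kurims p. 106, for
a hyperbolic Riemann surface `X = ℍ/Λ̄`: `Aut(X) = N_{PSL₂(ℝ)}(Λ̄)/Λ̄` is a FINITE subgroup of `Out(Λ̄)`).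

PROOF-ONLY file (no definition, no named fact).  Everything is a corollary of the tree's
`eq_one_of_forall_commute_toCompletion_of_isFreeOrSurface` (`C_{M̂}(η Λ) = 1`,
`SurfaceNormalSubgroupCompletionCentralizer.lean` / `FreeNormalSubgroupCompletionCentralizer.lean`):

* `mem_of_conj_profinitelyInner` — **(OUT-N)**: `Λ ⊴ M` normal of finite index, free of finite rank or an
  orientable surface group, `C_M(Λ) = 1`; if conjugation by `m ∈ M` is PROFINITELY INNER on `Λ` — there is
  `z ∈ Λ̂` with `η_Λ(m λ m⁻¹) = z⁻¹ η_Λ(λ) z` for all `λ ∈ Λ` (the hypothesis shape of abc-iut-w5-d144's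
  `map_eq_of_eta_conj`) — then `m ∈ Λ`.  Equivalently `M/Λ ↪ Out(Λ̂)`.  Proof: with the comparison
  `ι : Λ̂ → M̂`, the element `ι(z) · η_M(m)` commutes with `η_M(Λ)`, hence is trivial; so
  `η_M(m) = ι(z)⁻¹ ∈ closure η_M(Λ)`, i.e. `m ∈ Λ` (`toCompletion_mem_closure_image_iff`);
* `center_eq_bot_of_isFreeOrSurface` — a non-abelian free/surface group is centre-free (`Λ̂` slim, `η_Λ`
  injective);
* `exists_eq_conj_of_profinitelyInner_of_pow_inner` — **(OUT-FIN)**: for `Λ` non-abelian, free of finite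
  rank or an orientable surface group, an automorphism `φ` of FINITE ORDER MODULO `Inn(Λ)` (`φ^n` inner for
  some `n ≥ 1`) which is profinitely inner IS inner — i.e. `Out(Λ) → Out(Λ̂)` is injective on torsion
  elements, hence on every finite subgroup (applied to `M := ⟨Inn Λ, φ⟩ ≤ MulAut Λ`).

Honest limit: nothing is said about outer classes of INFINITE order (that is E. K. Grossman, J. London
Math. Soc. (2) 9 (1974) 160–164: conjugacy separability + "class-preserving ⇒ inner"; the second input is
not in the tree).  The normaliser at `PSL₂(ℝ)` (`Aut(ℍ/Γ̄) ↪ Out(Γ̂)` under `[N(Γ̄):Γ̄] < ∞`) is the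
consumer's one-liner from (OUT-N) and abc-iut-L4-t14's `psl_centralizer_eq_bot`; not restated here.
Classical group theory; OUR kernel check; nothing here bears on [IUTchIII] Cor. 3.12 or takes a side.
-/

noncomputable section

namespace Literature.GroupTheory

open Literature.AlgebraicGeometry.Frobenioids (IsSlimGroup)
open Literature.IUT.HodgeTheaters (profiniteCompletion toCompletion IsOrientableSurfaceGroup
  IsFreeOrSurface)
open Literature.IUT.HodgeTheaters.ProfiniteCompletion
open CategoryTheory ProfiniteGrp ProfiniteGrp.ProfiniteCompletion
open _root_.Topology
open scoped Pointwise

universe u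

variable {M : Type u} [Group M]

/-! ### (OUT-N): `M/Λ ↪ Out(Λ̂)` -/

/-- **(OUT-N).**  Let `Λ ⊴ M` be normal of finite index, free of finite rank or an orientable surface
group, with `C_M(Λ) = 1`.  If conjugation by `m ∈ M` is profinitely inner on `Λ` (`η_Λ(m λ m⁻¹) =
z⁻¹ η_Λ(λ) z` for some `z ∈ Λ̂` and all `λ ∈ Λ`), then `m ∈ Λ`: the finite group `M/Λ` embeds in
`Out(Λ̂)`.  For `M = N_{PSL₂(ℝ)}(Λ̄)`: `Aut(ℍ/Λ̄) ↪ Out(π̂₁)`, the (OUT) input of [AbsTopIII] Prop. 4.2 (i).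
[cite: MochizukiAbsTopIII2015, Proposition 4.2 (i) proof p.106] -/
theorem mem_of_conj_profinitelyInner (Λ : Subgroup M) [Λ.FiniteIndex] [Λ.Normal]
    (hΛ : IsFreeOrSurface Λ) (hC : Subgroup.centralizer (Λ : Set M) = ⊥) {m : M}
    (z : profiniteCompletion Λ)
    (hz : ∀ l : Λ, toCompletion Λ ⟨m * l * m⁻¹, ‹Λ.Normal›.conj_mem (l : M) l.2 m⟩ =
      z⁻¹ * toCompletion Λ l * z) : m ∈ Λ := by
  obtain ⟨ι, -, -, hιη, hιr⟩ := exists_comparison Λ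
  -- `ι(z) · η(m)` commutes with `η(Λ)`
  have hy : ∀ l ∈ Λ, (ι z * toCompletion M m) * toCompletion M l =
      toCompletion M l * (ι z * toCompletion M m) := by
    intro l hl
    have h1 : toCompletion M (m * l * m⁻¹) = (ι z)⁻¹ * toCompletion M l * ι z := by
      have := congrArg ι (hz ⟨l, hl⟩)
      rw [hιη] at this
      rw [map_mul ι, map_mul ι, map_inv ι, hιη] at this
      exact this
    rw [map_mul, map_mul, map_inv] at h1
    -- `h1 : η m * η l * (η m)⁻¹ = (ι z)⁻¹ * η l * ι z`
    calc ι z * toCompletion M m * toCompletion M l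
        = ι z * (toCompletion M m * toCompletion M l * (toCompletion M m)⁻¹) * toCompletion M m := by
          group
      _ = ι z * ((ι z)⁻¹ * toCompletion M l * ι z) * toCompletion M m := by rw [h1]
      _ = toCompletion M l * (ι z * toCompletion M m) := by group
  have h1 := eq_one_of_forall_commute_toCompletion_of_isFreeOrSurface Λ hΛ hC _ hy
  have hm : toCompletion M m = ι z⁻¹ := by
    rw [map_inv]; exact eq_inv_of_mul_eq_one_right h1
  have hmem : toCompletion M m ∈ closure (toCompletion M '' (Λ : Set M)) := by
    rw [hm, ← hιr]; exact ⟨z⁻¹, rfl⟩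
  exact (toCompletion_mem_closure_image_iff Λ m).mp hmem

/-! ### Centre-freeness of non-abelian free / surface groups -/

/-- A non-abelian group which is free of finite rank or an orientable surface group is CENTRE-FREE: a
central `z` has `η(z)` central in the slim group `Λ̂` (density), so `η(z) = 1`, so `z = 1` (`η`
injective). [cite: MochizukiAbsAnab2004, Lemma 1.3.1 p.15] -/
theorem center_eq_bot_of_isFreeOrSurface (L : Type u) [Group L] (hL : IsFreeOrSurface L)
    (hab : ∃ a b : L, a * b ≠ b * a) : Subgroup.center L = ⊥ := by
  -- slimness of `L̂` and injectivity of `η`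
  have hslim : IsSlimGroup (profiniteCompletion L) ∧ Function.Injective (toCompletion L) := by
    rcases hL with hfree | hsurf
    · haveI := Literature.IUT.HodgeTheaters.FreeOrSurface.isFreeGroup_of_isFreeOfFiniteRank hfree
      haveI := Literature.IUT.HodgeTheaters.FreeOrSurface.residuallyFinite_of_isFreeGroup L
      exact ⟨isSlimGroup_profiniteCompletion_of_isFreeGroup hab,
        (etaFn_injective_iff_residuallyFinite (GrpCat.of L)).mpr inferInstance⟩
    · obtain ⟨h1, -, h3, -⟩ := surfaceGroup_hyps L hsurf
      exact ⟨h1, h3⟩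
  obtain ⟨hs, hη⟩ := hslim
  rw [eq_bot_iff]
  intro c hc
  rw [Subgroup.mem_center_iff] at hc
  rw [Subgroup.mem_bot]
  apply hη
  rw [map_one]
  have hcen : ∀ w : profiniteCompletion L, w * toCompletion L c = toCompletion L c * w := fun w =>
    (denseRange (GrpCat.of L)).induction_on w
      (isClosed_eq (continuous_id.mul continuous_const) (continuous_const.mul continuous_id))
      (fun g => by
        change toCompletion L g * toCompletion L c = toCompletion L c * toCompletion L g
        rw [← map_mul, ← map_mul, hc g])
  have hmem : toCompletion L c ∈ Subgroup.centralizer ((⊤ : Subgroup (profiniteCompletion L)) : Set _) := by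
    rw [Subgroup.mem_centralizer_iff]
    exact fun w _ => hcen w
  rwa [hs.centralizer_eq_bot ⊤ (by rw [Subgroup.coe_top]; exact isOpen_univ), Subgroup.mem_bot] at hmem

/-! ### (OUT-FIN): finite-order outer automorphisms -/

/-- In `MulAut Λ`, an automorphism conjugates the inner automorphism of `g` to the inner automorphism of
its image: `α ∘ conj_g ∘ α⁻¹ = conj_{α g}`. [folklore] -/
private theorem mulAut_conj_conj {L : Type u} [Group L] (α : MulAut L) (g : L) :
    α * MulAut.conj g * α⁻¹ = MulAut.conj (α g) := by
  ext x
  change α (MulAut.conj g (α⁻¹ x)) = MulAut.conj (α g) x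
  rw [MulAut.conj_apply, MulAut.conj_apply, map_mul, map_mul, map_inv]
  change α g * α (α.symm x) * (α g)⁻¹ = _
  rw [MulEquiv.apply_symm_apply]

/-- **(OUT-FIN): `Out(Λ) → Out(Λ̂)` is injective on elements of finite order.**  Let `Λ` be non-abelian,
free of finite rank or an orientable surface group, and `φ` an automorphism of `Λ` of finite order modulo
inner automorphisms (`φ ^ n = conj_c` for some `n ≥ 1`, `c ∈ Λ`).  If `φ` is profinitely inner
(`η(φ g) = z⁻¹ η(g) z` for some `z ∈ Λ̂` and all `g`), then `φ` is inner.  Hence every FINITE subgroup of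
`Out(Λ)` maps injectively to `Out(Λ̂)` — in particular `Aut(X) ↪ Out(π̂₁(X))` for a hyperbolic Riemann
surface `X` with `|Aut X| < ∞`, the residual (OUT) of [AbsTopIII] Prop. 4.2 (i).
[cite: MochizukiAbsTopIII2015, Proposition 4.2 (i) proof p.106] -/
theorem exists_eq_conj_of_profinitelyInner_of_pow_inner (L : Type u) [Group L] (hL : IsFreeOrSurface L)
    (hab : ∃ a b : L, a * b ≠ b * a) (φ : MulAut L) {n : ℕ} (hn : 0 < n) (c : L)
    (hφn : φ ^ n = MulAut.conj c) (z : profiniteCompletion L)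
    (hz : ∀ g : L, toCompletion L (φ g) = z⁻¹ * toCompletion L g * z) :
    ∃ h : L, φ = MulAut.conj h := by
  classical
  -- the inner automorphisms `Inn ≤ MulAut L`, normal, and `M := Inn ⊔ ⟨φ⟩`
  have hZ := center_eq_bot_of_isFreeOrSurface L hL hab
  let Inn : Subgroup (MulAut L) := (MulAut.conj : L →* MulAut L).range
  haveI hInnN : Inn.Normal := ⟨by
    rintro _ ⟨g, rfl⟩ α
    exact ⟨α g, (mulAut_conj_conj α g).symm⟩⟩
  let Mφ : Subgroup (MulAut L) := Inn ⊔ Subgroup.zpowers φ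
  let Λ' : Subgroup Mφ := Inn.subgroupOf Mφ
  have hφM : φ ∈ Mφ := Subgroup.mem_sup_right (Subgroup.mem_zpowers φ)
  have hconjM : ∀ g : L, MulAut.conj g ∈ Mφ := fun g => Subgroup.mem_sup_left ⟨g, rfl⟩
  -- `conj : L → Inn` is injective (centre-free)
  have hconj_inj : Function.Injective (MulAut.conj : L →* MulAut L) := by
    rw [injective_iff_map_eq_one]
    intro g hg
    have : g ∈ Subgroup.center L := by
      rw [Subgroup.mem_center_iff]
      intro x
      have := congrArg (fun α : MulAut L => α x) hg
      simp only [MulAut.conj_apply, MulAut.one_apply] at this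
      calc x * g = (g * x * g⁻¹) * g := by rw [this]
        _ = g * x := by group
    rwa [hZ, Subgroup.mem_bot] at this
  -- the isomorphism `e : L ≃* Λ'`
  let eM : L →* Mφ := MonoidHom.codRestrict (MulAut.conj : L →* MulAut L) Mφ hconjM
  have heM_range : ∀ x : Mφ, x ∈ Λ' ↔ ∃ g, eM g = x := fun x => by
    rw [Subgroup.mem_subgroupOf]
    constructor
    · rintro ⟨g, hg⟩; exact ⟨g, Subtype.ext hg⟩
    · rintro ⟨g, hg⟩; exact ⟨g, by rw [← hg]; rfl⟩
  let e₀ : L →* Λ' := eM.codRestrict Λ' fun g => (heM_range _).mpr ⟨g, rfl⟩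
  have he₀_bij : Function.Bijective e₀ := by
    refine ⟨fun a b h => hconj_inj ?_, fun x => ?_⟩
    · have := congrArg (fun t : Λ' => ((t : Mφ) : MulAut L)) h
      exact this
    · obtain ⟨g, hg⟩ := (heM_range x.1).mp x.2
      exact ⟨g, Subtype.ext hg⟩
  let e : L ≃* Λ' := MulEquiv.ofBijective e₀ he₀_bij
  have he : ∀ g : L, (((e g : Λ') : Mφ) : MulAut L) = MulAut.conj g := fun _ => rfl
  -- `Λ'` is free / surface, of finite index (every element of `Mφ` is `conj_g · φ^i`, and `φ^n ∈ Inn`)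
  have hΛ' : IsFreeOrSurface Λ' := by
    rcases hL with ⟨k, ⟨f⟩⟩ | ⟨g, hg, ⟨f⟩⟩
    · exact Or.inl ⟨k, ⟨e.symm.trans f⟩⟩
    · exact Or.inr ⟨g, hg, ⟨e.symm.trans f⟩⟩
  haveI : Λ'.FiniteIndex := by
    let φ' : Mφ := ⟨φ, hφM⟩
    have hφ'n : φ' ^ n ∈ Λ' := by
      rw [Subgroup.mem_subgroupOf]
      change φ ^ n ∈ Inn
      rw [hφn]; exact ⟨c, rfl⟩
    have hsurj : ∀ q : Mφ ⧸ Λ', ∃ i : Fin n, q = QuotientGroup.mk (φ' ^ (i : ℕ)) := by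
      intro q
      obtain ⟨x, rfl⟩ := QuotientGroup.mk_surjective q
      have hx : (x : MulAut L) ∈ (Inn : Set (MulAut L)) * (Subgroup.zpowers φ : Set (MulAut L)) := by
        rw [← Subgroup.normal_mul]; exact x.2
      obtain ⟨a, ha, b, hb, hab'⟩ := Set.mem_mul.mp hx
      obtain ⟨k, rfl⟩ := Subgroup.mem_zpowers_iff.mp hb
      -- `x = a * φ^k`, so `mk x = mk φ' ^ k = mk φ' ^ (k mod n)`
      have hxa : x = ⟨a, Subgroup.mem_sup_left ha⟩ * φ' ^ k := by
        apply Subtype.ext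
        rw [← hab']
        rfl
      refine ⟨⟨(k % (n : ℤ)).toNat, ?_⟩, ?_⟩
      · have h0 : 0 ≤ k % (n : ℤ) := Int.emod_nonneg _ (by exact_mod_cast hn.ne')
        have h1 : k % (n : ℤ) < n := Int.emod_lt_of_pos _ (by exact_mod_cast hn)
        omega
      · rw [hxa, QuotientGroup.mk_mul, (QuotientGroup.eq_one_iff _).mpr
          ((Subgroup.mem_subgroupOf).mpr (by exact ha)), one_mul, QuotientGroup.mk_zpow,
          QuotientGroup.mk_pow]
        have hord : (QuotientGroup.mk φ' : Mφ ⧸ Λ') ^ (n : ℤ) = 1 := by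
          rw [zpow_natCast, ← QuotientGroup.mk_pow, QuotientGroup.eq_one_iff]; exact hφ'n
        have h0 : 0 ≤ k % (n : ℤ) := Int.emod_nonneg _ (by exact_mod_cast hn.ne')
        conv_lhs => rw [← Int.emod_add_mul_ediv k n, zpow_add, zpow_mul, hord, one_zpow, mul_one]
        rw [← zpow_natCast, Int.toNat_of_nonneg h0]
    haveI : Finite (Mφ ⧸ Λ') :=
      Finite.of_surjective (fun i : Fin n => (QuotientGroup.mk (φ' ^ (i : ℕ)) : Mφ ⧸ Λ'))
        fun q => by obtain ⟨i, hi⟩ := hsurj q; exact ⟨i, hi.symm⟩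
    exact Subgroup.finiteIndex_of_finite_quotient
  -- `C_{Mφ}(Λ') = 1`
  have hC : Subgroup.centralizer (Λ' : Set Mφ) = ⊥ := by
    rw [eq_bot_iff]
    intro α hα
    rw [Subgroup.mem_centralizer_iff] at hα
    rw [Subgroup.mem_bot]
    apply Subtype.ext
    change (α : MulAut L) = 1
    -- `α` commutes with every `conj_g`, so `α g · g⁻¹` is central, so `α g = g`
    ext x
    change (α : MulAut L) x = x
    have key : ∀ g : L, ((α : MulAut L) g)⁻¹ * g ∈ Subgroup.center L := by
      intro g
      have h1 := hα (e g) (e g).2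
      have h2 : MulAut.conj g * (α : MulAut L) = (α : MulAut L) * MulAut.conj g :=
        congrArg (fun t : Mφ => (t : MulAut L)) h1
      rw [Subgroup.mem_center_iff]
      intro y
      obtain ⟨w, rfl⟩ := (α : MulAut L).surjective y
      have h3 := congrArg (fun β : MulAut L => β w) h2
      simp only [MulAut.mul_apply, MulAut.conj_apply, map_mul, map_inv] at h3
      -- `h3 : g * α w * g⁻¹ = α g * α w * (α g)⁻¹`
      calc (α : MulAut L) w * (((α : MulAut L) g)⁻¹ * g)
          = ((α : MulAut L) g)⁻¹ * ((α : MulAut L) g * (α : MulAut L) w * ((α : MulAut L) g)⁻¹)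
              * ((α : MulAut L) g) * (((α : MulAut L) g)⁻¹ * g) := by group
        _ = ((α : MulAut L) g)⁻¹ * (g * (α : MulAut L) w * g⁻¹) * ((α : MulAut L) g)
              * (((α : MulAut L) g)⁻¹ * g) := by rw [h3]
        _ = ((α : MulAut L) g)⁻¹ * g * (α : MulAut L) w := by group
    have hx := key x
    rw [hZ, Subgroup.mem_bot, inv_mul_eq_one] at hx
    exact hx
  -- the profinitely-inner hypothesis, transported to `Λ' ≤ Mφ` along `ê : Λ̂ → Λ̂'`
  let fG : GrpCat.of L ⟶ GrpCat.of (profiniteCompletion Λ') :=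
    GrpCat.ofHom ((toCompletion Λ').comp e.toMonoidHom)
  let ê := (ProfiniteCompletion.lift (G := GrpCat.of L) (P := profiniteCompletion Λ') fG).hom.toMonoidHom
  have hê : ∀ g : L, ê (toCompletion L g) = toCompletion Λ' (e g) := fun g =>
    ConcreteCategory.congr_hom (ProfiniteCompletion.lift_eta fG) g
  let φ' : Mφ := ⟨φ, hφM⟩
  have hconjφ : ∀ g : L, φ' * (e g : Mφ) * φ'⁻¹ = (e (φ g) : Mφ) := fun g => by
    apply Subtype.ext
    change φ * MulAut.conj g * φ⁻¹ = MulAut.conj (φ g)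
    exact mulAut_conj_conj φ g
  have hz' : ∀ l : Λ', toCompletion Λ' ⟨φ' * l * φ'⁻¹, (inferInstance : Λ'.Normal).conj_mem (l : Mφ) l.2 φ'⟩ =
      (ê z)⁻¹ * toCompletion Λ' l * ê z := by
    intro l
    obtain ⟨g, rfl⟩ := e.surjective l
    have h1 : (⟨φ' * (e g : Mφ) * φ'⁻¹, (inferInstance : Λ'.Normal).conj_mem ((e g : Λ') : Mφ) (e g).2 φ'⟩ : Λ')
        = e (φ g) := Subtype.ext (hconjφ g)
    rw [h1, ← hê, ← hê, hz g, map_mul, map_mul, map_inv]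
  -- (OUT-N) in `Mφ`: `φ' ∈ Λ'`, i.e. `φ` is inner
  have hmem := mem_of_conj_profinitelyInner Λ' hΛ' hC (ê z) hz'
  rw [Subgroup.mem_subgroupOf] at hmem
  obtain ⟨h, hh⟩ := hmem
  exact ⟨h, hh.symm⟩

end Literature.GroupTheory

end
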